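import Mathlib
import Summits.NavierStokesRegularity.NavierStokesRegularity.Theorems.FilamentSkeletonRssStadiumBaseMargin
import Summits.NavierStokesRegularity.NavierStokesRegularity.Theorems.FilamentSkeletonRssStadiumMarginKernel
import Summits.NavierStokesRegularity.NavierStokesRegularity.Theorems.FilamentSkeletonRssStadiumFixedSourcePiece

/-!
# The frozen PLATEAU piece is holomorphic near its height (`TangentSkeletonNearStraightL`, stmt-NavierStokesRegularity-23320, registered stub
# `stub_stripPropagation` — blueprint item R2 of `DIAG-addendum-contour-g2.md`)

Stub context (stadium `S`, `F` with `Σ(F′)² = 1`, `‖F′‖ ≤ M`, `F = cplx∘X` on the trace, unit-speed near-straight `X`, core continuation `G` with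
`Re G ≥ Λ⁻¹/2` on `S`, `κ > 0`).  Plateau `[a,b] + iy₀` with `y₀ = Im z₀`, all its points carrying `n`-fold discs; the plateau data are extended
continuously to `ℝ` by the clamp (Theorems.StadiumMarginKernel).  If `δ ≤ m·r₀`, `3M²(r₀+δ)² ≤ κΛ⁻¹/4` and the slope coefficient
`(1−m²)A₁ − 2mA₂ > 0` (numbers of the retype: `n = 8`, any `m ≤ 1/7`), then on the ball `|z − z₀| < δ` (inside `S`, targets with `n`-fold discs) the
frozen plateau integral `z ↦ ∫_{[a,b]} K(z, t + iy₀) dt` is holomorphic (`plateauPiece_differentiableOn`): Theorems.StadiumFixedSourcePiece with the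
uniform margin of Theorems.StadiumBaseMargin and the constant dominating function of Theorems.StadiumMarginKernel.  (The two connector pieces are the
same statement with the vertical clamp; left to the assembler.)  HONEST FRAMING: a tool for a HYPOTHETICAL filament skeleton on the NEGATIVE side of a
MODEL route; nothing here bears on Navier–Stokes regularity or blow-up.  `--supports stmt-NavierStokesRegularity-23320`.
-/

set_option linter.dupNamespace false

noncomputable section

namespace Summit.NavierStokesRegularity.NavierStokesRegularity.Theorems.StadiumPlateauPiece

open Set Metric MeasureTheory
open scoped InnerProductSpace Matrix
open Summit.NavierStokesRegularity.NavierStokesRegularity.Theorems.StadiumBaseMargin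
open Summit.NavierStokesRegularity.NavierStokesRegularity.Theorems.StadiumMarginKernel
open Summit.NavierStokesRegularity.NavierStokesRegularity.Theorems.StadiumChordCrude
open Summit.NavierStokesRegularity.NavierStokesRegularity.Theorems.StadiumFixedSourcePiece

/-- **The frozen plateau piece is holomorphic near its height.**  See the module docstring. [folklore] -/
theorem plateauPiece_differentiableOn {hs L cc M Rb n m r₀ δ κ Λ a b : ℝ} {F : ℂ → (Fin 3 → ℂ)} {G : ℂ → ℂ}
    (hF : DifferentiableOn ℂ F {z : ℂ | |z.im| < hs ∧ |z.re - cc| < L + hs})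
    (hunit : ∀ w ∈ {z : ℂ | |z.im| < hs ∧ |z.re - cc| < L + hs}, ∑ i, (deriv F w i) ^ 2 = 1)
    (hM : ∀ z ∈ {z : ℂ | |z.im| < hs ∧ |z.re - cc| < L + hs}, ‖deriv F z‖ ≤ M)
    {X : ℝ → EuclideanSpace ℝ (Fin 3)} (hX : Differentiable ℝ X) (hXu : ∀ τ, ‖deriv X τ‖ = 1)
    (hosc : ∀ τ σ, ‖deriv X τ - deriv X σ‖ ≤ Rb)
    (hFX : ∀ r : ℝ, (r : ℂ) ∈ {z : ℂ | |z.im| < hs ∧ |z.re - cc| < L + hs} →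
      F r = fun i => ((⟪X r, EuclideanSpace.single i (1:ℝ)⟫_ℝ : ℝ) : ℂ))
    (hG : DifferentiableOn ℂ G {z : ℂ | |z.im| < hs ∧ |z.re - cc| < L + hs})
    (hGre : ∀ w ∈ {z : ℂ | |z.im| < hs ∧ |z.re - cc| < L + hs}, Λ⁻¹ / 2 ≤ (G w).re)
    (hn : 1 < n) (hκ : 0 < κ) (hΛ : 0 < Λ) (hab : a ≤ b) {z₀ : ℂ}
    -- the plateau at height `Im z₀`: inside `S` with `n`-fold discs
    (hplS : ∀ t ∈ Icc a b, ((t : ℂ) + ((z₀.im : ℝ) : ℂ) * Complex.I) ∈ {z : ℂ | |z.im| < hs ∧ |z.re - cc| < L + hs})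
    (hplfit : n * |z₀.im| < hs) (hplfit' : ∀ t ∈ Icc a b, |t - cc| + n * |z₀.im| < L + hs)
    -- the targets: the ball of radius `δ` around `z₀`, inside `S` with `n`-fold discs
    (hballS : ball z₀ δ ⊆ {z : ℂ | |z.im| < hs ∧ |z.re - cc| < L + hs})
    (hballfit : ∀ z ∈ ball z₀ δ, n * |z.im| < hs ∧ |z.re - cc| + n * |z.im| < L + hs)
    -- margin parameters
    (hm0 : 0 ≤ m) (hm1 : m ≤ 1) (hr₀ : 0 < r₀) (hδm : δ ≤ m * r₀) (hsmall : 3 * M ^ 2 * (r₀ + δ) ^ 2 ≤ κ * Λ⁻¹ / 4)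
    (hA : 0 ≤ 1 - (Rb + 2 * (√3 * (2 * M * (Real.log (n / (n - 1)) - 1 / n)))) ^ 2 / 2)
    (hC : 0 < (1 - m ^ 2) * (1 - (Rb + 2 * (√3 * (2 * M * (Real.log (n / (n - 1)) - 1 / n)))) ^ 2 / 2) -
      2 * m * (2 * (√3 * (M * Real.log (n / (n - 1)))) * (Rb + 2 * (√3 * (2 * M * (Real.log (n / (n - 1)) - 1 / n)))))) :
    DifferentiableOn ℂ (fun z => ∫ t in Icc a b,
      (((∑ i, (F z i - F ((((max a (min t b) : ℝ)) : ℂ) + ((z₀.im : ℝ) : ℂ) * Complex.I) i) ^ 2) +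
          (κ : ℂ) * G ((((max a (min t b) : ℝ)) : ℂ) + ((z₀.im : ℝ) : ℂ) * Complex.I)) ^ ((3:ℂ) / 2))⁻¹ •
        (deriv F ((((max a (min t b) : ℝ)) : ℂ) + ((z₀.im : ℝ) : ℂ) * Complex.I) ⨯₃
          (fun i => F z i - F ((((max a (min t b) : ℝ)) : ℂ) + ((z₀.im : ℝ) : ℂ) * Complex.I) i))) (ball z₀ δ) := by
  set S : Set ℂ := {z : ℂ | |z.im| < hs ∧ |z.re - cc| < L + hs} with hS
  have hSo : IsOpen S := by
    have h1 : IsOpen {z : ℂ | |z.im| < hs} := isOpen_lt (continuous_abs.comp Complex.continuous_im) continuous_const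
    have h2 : IsOpen {z : ℂ | |z.re - cc| < L + hs} :=
      isOpen_lt (continuous_abs.comp (Complex.continuous_re.sub continuous_const)) continuous_const
    exact h1.inter h2
  set y₀ : ℝ := z₀.im with hy₀
  set cl : ℝ → ℝ := fun t => max a (min t b) with hcl
  have hcl_mem : ∀ t, cl t ∈ Icc a b := fun t => ⟨le_max_left _ _, max_le hab (min_le_right _ _)⟩
  set ζf : ℝ → ℂ := fun t => ((cl t : ℝ) : ℂ) + ((y₀ : ℝ) : ℂ) * Complex.I with hζf
  have hζS : ∀ t, ζf t ∈ S := fun t => hplS _ (hcl_mem t)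
  have hζim : ∀ t, (ζf t).im = y₀ := fun t => by simp [hζf]
  have hζre : ∀ t, (ζf t).re = cl t := fun t => by simp [hζf]
  -- continuity of the clamped data
  have hP : Continuous fun t : ℝ => F (ζf t) := continuous_plateau_clamp hF.continuousOn hab hplS
  have hdF : ContinuousOn (deriv F) S := ((hF.analyticOnNhd hSo).deriv).continuousOn
  have hD : Continuous fun t : ℝ => deriv F (ζf t) := continuous_plateau_clamp hdF hab hplS
  have hGc : Continuous fun t : ℝ => G (ζf t) := continuous_plateau_clamp hG.continuousOn hab hplS
  -- the margin
  set C : ℝ := (1 - m ^ 2) * (1 - (Rb + 2 * (√3 * (2 * M * (Real.log (n / (n - 1)) - 1 / n)))) ^ 2 / 2) -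
      2 * m * (2 * (√3 * (M * Real.log (n / (n - 1)))) * (Rb + 2 * (√3 * (2 * M * (Real.log (n / (n - 1)) - 1 / n))))) with hCdef
  set m₀ : ℝ := min (κ * Λ⁻¹ / 4) (r₀ ^ 2 * C) with hm₀def
  have hm₀pos : 0 < m₀ := lt_min (by positivity) (by positivity)
  have hmargin : ∀ z ∈ ball z₀ δ, ∀ t : ℝ, m₀ ≤ ((∑ i, (F z i - F (ζf t) i) ^ 2) + (κ : ℂ) * G (ζf t)).re := by
    intro z hz t
    have hzS : z ∈ S := hballS hz
    obtain ⟨hzfit, hzfit'⟩ := hballfit z hz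
    have hζfit : n * |(ζf t).im| < hs := by rw [hζim]; exact hplfit
    have hζfit' : |(ζf t).re - cc| + n * |(ζf t).im| < L + hs := by rw [hζim, hζre]; exact hplfit' _ (hcl_mem t)
    have hδ' : |z.im - (ζf t).im| ≤ δ := by
      rw [hζim]
      have h := Complex.abs_im_le_norm (z - z₀)
      rw [Complex.sub_im] at h
      have hzz : ‖z - z₀‖ < δ := by rwa [mem_ball, dist_eq_norm] at hz
      simp only [hy₀]; linarith
    have h := base_re_margin hF hunit hM hX hXu hosc hFX hn hzS (hζS t) hzfit hzfit' hζfit hζfit' hκ hΛ (hGre _ (hζS t))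
      hm0 hm1 hr₀ hδ' hδm hsmall hA hC.le
    rw [← hCdef] at h
    exact h
  have hpos : ∀ z ∈ ball z₀ δ, ∀ t ∈ Icc a b, 0 < ((∑ i, (F z i - F (ζf t) i) ^ 2) + (κ : ℂ) * G (ζf t)).re :=
    fun z hz t _ => lt_of_lt_of_le hm₀pos (hmargin z hz t)
  -- the dominating constant
  set R₁ : ℝ := δ + |z₀.re - a| + |z₀.re - b| with hR₁
  have hdist : ∀ z ∈ ball z₀ δ, ∀ t : ℝ, ‖z - ζf t‖ ≤ R₁ := by
    intro z hz t
    have hzz : ‖z - z₀‖ < δ := by rwa [mem_ball, dist_eq_norm] at hz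
    have h1 : ‖z₀ - ζf t‖ ≤ |z₀.re - cl t| + |z₀.im - y₀| := by
      have h := Complex.norm_le_abs_re_add_abs_im (z₀ - ζf t)
      rw [Complex.sub_re, Complex.sub_im, hζre, hζim] at h
      exact h
    have h2 : |z₀.im - y₀| = 0 := by simp [hy₀]
    have h3 : |z₀.re - cl t| ≤ |z₀.re - a| + |z₀.re - b| := by
      have hm := hcl_mem t
      rcases le_total (z₀.re) (cl t) with h | h
      · rw [abs_of_nonpos (by linarith)]
        have : |z₀.re - b| ≥ -(z₀.re - b) := neg_le_abs _
        linarith [hm.2, abs_nonneg (z₀.re - a)]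
      · rw [abs_of_nonneg (by linarith)]
        have : |z₀.re - a| ≥ z₀.re - a := le_abs_self _
        linarith [hm.1, abs_nonneg (z₀.re - b)]
    calc ‖z - ζf t‖ ≤ ‖z - z₀‖ + ‖z₀ - ζf t‖ := norm_sub_le_norm_sub_add_norm_sub _ _ _
      _ ≤ R₁ := by rw [hR₁]; linarith
  have hM0 : 0 ≤ M := by
    have := hM _ (hζS a); exact (norm_nonneg _).trans this
  have hdom : ∀ z ∈ ball z₀ δ, ∀ t ∈ Icc a b,
      ‖(((∑ i, (F z i - F (ζf t) i) ^ 2) + (κ : ℂ) * G (ζf t)) ^ ((3:ℂ) / 2))⁻¹ •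
        (deriv F (ζf t) ⨯₃ (fun i => F z i - F (ζf t) i))‖ ≤ m₀ ^ (-(3/2 : ℝ)) * (2 * M ^ 2 * R₁) := by
    intro z hz t _
    have hzS : z ∈ S := hballS hz
    have hseg : segment ℝ (ζf t) z ⊆ S := (stadium_convex hs L cc).segment_subset (hζS t) hzS
    have hdiff : ∀ u ∈ segment ℝ (ζf t) z, DifferentiableAt ℂ F u := fun u hu => hF.differentiableAt (hSo.mem_nhds (hseg hu))
    have hMseg : ∀ u ∈ segment ℝ (ζf t) z, ‖deriv F u‖ ≤ M := fun u hu => hM u (hseg hu)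
    have hfun : (fun i => F z i - F (ζf t) i) = F z - F (ζf t) := by funext i; simp [Pi.sub_apply]
    rw [hfun]
    exact kernel_norm_le_of_margin_chord hm₀pos (hmargin z hz t) (hM _ (hζS t)) hdiff hMseg (hdist z hz t)
  have hbound : IntegrableOn (fun _ : ℝ => m₀ ^ (-(3/2 : ℝ)) * (2 * M ^ 2 * R₁)) (Icc a b) := by
    exact (continuous_const).integrableOn_Icc
  have h := differentiableOn_fixedSourcePiece (Metric.isOpen_ball) (hF.mono hballS) hP hD hGc measurableSet_Icc hpos hbound hdom
  exact h

end Summit.NavierStokesRegularity.NavierStokesRegularity.Theorems.StadiumPlateauPiece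

end
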